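import Mathlib.Data.Finite.Sum
import Literature.AnabelianGeometry.SemiGraphs.ArithOuterActionCongruenceAutomatic
import Literature.AnabelianGeometry.SemiGraphs.SubgroupPresentationStabilizers
import Literature.AnabelianGeometry.SemiGraphs.SemiGraphIsoTransport
import HarnessLib

/-!
# [SemiAnbd] Prop 5.2 (i) proof at the coset semi-graphs: rigidity of close deck-equivariant endomorphisms of a
# coset level of a subgroup presentation (piece (P2a) of the «T54-HCCT-PRODUCER» programme; proof-only)

Mochizuki, *Semi-graphs of anabelioids*, Publ. RIMS **42** (2006) 221–322, §5: Prop 5.2 (i) p. 63 and its proof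
p. 64 («… follow from the various finiteness assumptions in our definition of a "continuous action"»), the trees
`𝒢_{∞,i}` of the proof of Thm 3.7 (iii) p. 41, the decomposition groups of §5 p. 65.
[cite: MochizukiSemiAnbd2006, Prop 5.2 (i), p. 63]

PROOF-ONLY file (abc-iut cell, layer L3, row «T54-HCCT-PRODUCER» of abc-iut-L3-lead δ7 (7) / δ23; seat
abc-iut-w4-d085 gen 10; piece (P2a) of `HOME/staging/w4/w4-d085/g10/SHAPES-T54-HCCT.md`).  No definition, no
instance, no new named fact.  Pure group theory over abc-iut-L3-d4's `SubgroupPresentationCosetGraph.lean`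
(coset semi-graphs `P.cosetGraph K`, deck action `P.deckAct K`), abc-iut-w4-d059's
`SubgroupPresentationStabilizers.lean` (`deckAct_fixes_vMk_iff` / `…_eMk_iff`), abc-iut-L3-t6's
`SemiGraphIsoTransport.lean` (`Hom.nodeMap`, `subdivisionIso`) and this seat's generic
`ArithOuterActionCongruenceAutomatic.lean` §2 (p512058, `exists_finite_forall_closeEquivariant_conj`).

WHAT IS PROVED.  For a subgroup presentation `P` of a FINITE semi-graph `𝔾` in `Γ` and a NORMAL level `K`
such that the images of the vertex groups `H_w` and edge groups `M_ε` in `Γ ⧸ K` are FINITE and the coset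
semi-graph `P.cosetGraph K` is CONNECTED (e.g. a tree level of the tempered tower):

* `exists_finite_setOf_subdivision_adj_cosetGraph` — the barycentric subdivision of `P.cosetGraph K` is locally
  finite;
* `exists_finite_forall_deckAct_nodeMap_eq` — every node has finitely many stabilising deck classes in `Γ ⧸ K`;
* `exists_finite_forall_close_deckEquivariant_congr` — **RIGIDITY AT A COSET LEVEL**: there is a FINITE
  `E ⊆ Γ`, no element of which lies in `K`, such that for every NORMAL `L ⊇ K` avoiding `E`, every pair
  (`Ψ : Γ ≃* Γ` with `Ψ(K) = K`, `t : P.cosetGraph K ⟶ P.cosetGraph K`) that is DECK-EQUIVARIANT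
  (`deck(g) ≫ t = t ≫ deck(Ψ g)`) and `L`-CLOSE to the identity (every node `x` has `t x = deck(l) x` for some
  `l ∈ L`; `Ψ g · g⁻¹ ∈ L`) satisfies: `Ψ` is INNER MODULO `K` — `Ψ g = l₀ g l₀⁻¹ k_g`, `k_g ∈ K`, ONE `l₀ ∈ L` — and
  `t = deck(l₀)` on nodes.  (§2 of p512058 applied to `Γ ⧸ K` acting on the nodes of the subdivision through
  the deck action; the conclusion is exactly the hypothesis shape of p512058 §3
  `exists_rep_congr_of_forall_apply_eq_conj_mul`.)

INTENDED USE (piece (P3), not here): `Γ := π₁^temp(𝒢)` with the T54 presentation `D.piPresentation T R`,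
`K := ker (D.projAut n)` (a tree level: connected; `H_w` compact and `K` open: finite images), `t := (P.arithAct …
e).hom` for `e` in the outer semidirect product over `a ∈ Π_A` (abc-iut-L3-d4's `SubgroupPresentationArithAction`,
equivariance = `arithAct_mul` + `arithAct_eq_deckAct_of_inner`), `Ψ := Φ e`, `L :=` a deep finite
characteristic level times `K`; closeness = «the vertex / edge conjugators of `e` lie in `L`», a FINITE-valued
invariant modulo `L` — then p512058 §1 + §3 give the capstone binder `hCCt`.  HONEST LABEL: generic; nothing of
[SemiAnbd] is discharged by this file alone; no side taken on [IUTchIII] Cor. 3.12; typed ≠ proved.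
-/

namespace Literature.AnabelianGeometry.SemiGraphs

namespace SemiGraph

namespace SubgroupPresentation

open CategoryTheory
open scoped Pointwise

universe u

variable {𝔾 : SemiGraph.{u}} {Γ : Type u} [Group Γ] (P : SubgroupPresentation 𝔾 Γ) (K : Subgroup Γ)

/-! ### Local finiteness of the subdivision of a coset level -/

/-- The branches of the level-`K` coset semi-graph abutting to the vertex `H_w y K` are the `bMk b (s_b⁻¹ h y)` with
`b` a branch of `𝔾` abutting to `w` and `h ∈ H_w` (read modulo `K`).  Hence, if `𝔾` has finitely many branches and
the image of `H_w` in `Γ ⧸ K` is finite, the vertex has finitely many neighbours in the barycentric subdivision;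
edge- and branch-points always have finitely many.  [cite: MochizukiSemiAnbd2006, Thm 3.7(iii) p.41] -/
theorem exists_finite_setOf_subdivision_adj_cosetGraph [K.Normal] [Finite 𝔾.Branch]
    (hH : ∀ w : 𝔾.Vertex, ((QuotientGroup.mk (s := K)) '' (P.H w : Set Γ)).Finite)
    (x : (P.cosetGraph K).Node) : {y | (P.cosetGraph K).subdivision.Adj x y}.Finite := by
  classical
  rcases x with v | ε | br
  · -- vertex-point: neighbours are the points of the abutting branches
    obtain ⟨w, y, rfl⟩ := P.vMk_surjective K v
    -- candidate set: over all branches `b` of `𝔾` and all classes `q ∈ H_w K / K`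
    let F : Set (P.cosetGraph K).Node :=
      ⋃ b : 𝔾.Branch, (fun q : Γ ⧸ K =>
        (Sum.inr (Sum.inr (P.bMk K b ((P.s b)⁻¹ * q.out * y))) : (P.cosetGraph K).Node)) ''
          ((QuotientGroup.mk (s := K)) '' (P.H w : Set Γ))
    have hF : F.Finite := Set.finite_iUnion fun b => (hH w).image _
    refine hF.subset ?_
    intro z hz
    obtain ⟨br, hbr, rfl⟩ := ((P.cosetGraph K).subdivision_adj_inl_iff _ _).mp hz
    obtain ⟨b, y', rfl⟩ := P.bMk_surjective K br
    -- `b` abuts to a vertex of `𝔾` (else `bMk b y'` abuts to nothing)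
    rcases hb : 𝔾.abuts b with _ | w'
    · rw [P.cosetGraph_abuts_bMk_none K b hb] at hbr
      exact absurd hbr (by simp)
    rw [P.cosetGraph_abuts_bMk K b w' hb] at hbr
    have hvv : P.vMk K w' (P.s b * y') = P.vMk K w y := Option.some.inj hbr
    have hw : w' = w := congrArg Sigma.fst hvv
    subst hw
    obtain ⟨h, hh, k, hk, hyk⟩ := (DoubleCoset.eq _ _ _ _).mp ((P.vMk_eq_vMk_iff K).mp hvv)
    -- `y = h (s_b y') k`, so `y' = s_b⁻¹ h⁻¹ y k⁻¹`; the class of `h⁻¹` is the parameter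
    have hout : ∃ k₁ ∈ K, (QuotientGroup.mk (s := K) h⁻¹).out = h⁻¹ * k₁ := by
      refine ⟨(h⁻¹)⁻¹ * (QuotientGroup.mk (s := K) h⁻¹).out, ?_, by group⟩
      rw [← QuotientGroup.eq, QuotientGroup.out_eq']
    obtain ⟨k₁, hk₁, hout⟩ := hout
    refine Set.mem_iUnion.mpr ⟨b, ⟨QuotientGroup.mk h⁻¹, ⟨h⁻¹, (P.H w').inv_mem hh, rfl⟩, ?_⟩⟩
    -- the two representatives define the same edge class
    have hcl : DoubleCoset.mk (P.M (𝔾.edgeOf b)) K ((P.s b)⁻¹ * (QuotientGroup.mk (s := K) h⁻¹).out * y) =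
        DoubleCoset.mk (P.M (𝔾.edgeOf b)) K y' := by
      rw [DoubleCoset.eq]
      refine ⟨1, (P.M _).one_mem, (y⁻¹ * k₁ * y)⁻¹ * k⁻¹, K.mul_mem (K.inv_mem ?_) (K.inv_mem hk), ?_⟩
      · exact Subgroup.Normal.conj_mem' ‹K.Normal› k₁ hk₁ y
      · rw [hout, hyk]; group
    exact congrArg (fun br : (P.cosetGraph K).Branch => (Sum.inr (Sum.inr br) : (P.cosetGraph K).Node))
      (Subtype.ext (Prod.ext rfl (congrArg (Sigma.mk _) hcl)))
  · -- edge-point: neighbours are the points of its (two) branches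
    refine (Set.finite_range fun b : {b : 𝔾.Branch // ε.1 = 𝔾.edgeOf b} =>
      (Sum.inr (Sum.inr ⟨(b.1, ε), b.2⟩) : (P.cosetGraph K).Node)).subset ?_
    intro z hz
    obtain ⟨br, hbr, rfl⟩ := ((P.cosetGraph K).subdivision_adj_edge_iff _ _).mp hz
    obtain ⟨⟨b, ε'⟩, hε'⟩ := br
    cases hbr
    exact ⟨⟨b, hε'⟩, rfl⟩
  · -- branch-point: neighbours are its edge-point and the vertex it abuts to (at most one)
    have hsub : ({v : (P.cosetGraph K).Vertex | (P.cosetGraph K).abuts br = some v}).Subsingleton := by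
      intro v hv v' hv'
      exact Option.some.inj (hv.symm.trans hv')
    refine ((Set.finite_singleton (Sum.inr (Sum.inl ((P.cosetGraph K).edgeOf br)) : (P.cosetGraph K).Node)).union
      (hsub.finite.image fun v => (Sum.inl v : (P.cosetGraph K).Node))).subset ?_
    intro z hz
    rcases ((P.cosetGraph K).subdivision_adj_branch_iff _ _).mp hz with rfl | ⟨v, hv, rfl⟩
    · exact Or.inl rfl
    · exact Or.inr ⟨v, hv, rfl⟩

/-! ### Finiteness of the deck stabilisers modulo `K` -/

/-- **Deck stabilisers of nodes are finite modulo `K`**: if the images of the vertex groups `H_w` and of the edge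
groups `M_ε` in `Γ ⧸ K` are finite (`K` normal), then for every node `x` of the level-`K` coset semi-graph the
classes `g K` of the deck transformations fixing `x` form a finite set (for the vertex `H_w y K` they lie in
`ȳ⁻¹ (H_w K/K) ȳ`, `deckAct_fixes_vMk_iff`). [cite: MochizukiSemiAnbd2006, Thm 3.7(iii) p.41] -/
theorem exists_finite_forall_deckAct_nodeMap_eq [K.Normal]
    (hH : ∀ w : 𝔾.Vertex, ((QuotientGroup.mk (s := K)) '' (P.H w : Set Γ)).Finite)
    (hM : ∀ ε : 𝔾.Edge, ((QuotientGroup.mk (s := K)) '' (P.M ε : Set Γ)).Finite)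
    (x : (P.cosetGraph K).Node) :
    ∃ F : Set (Γ ⧸ K), F.Finite ∧ ∀ g : Γ, Hom.nodeMap (P.deckAct K g).hom x = x → (QuotientGroup.mk g : Γ ⧸ K) ∈ F := by
  classical
  -- the common computation: `y g y⁻¹ ∈ L · K` puts `g K` in `ȳ⁻¹ (L K / K) ȳ`
  have key : ∀ (L : Subgroup Γ) (y g : Γ), y * g * y⁻¹ ∈ (L : Set Γ) * (K : Set Γ) →
      (QuotientGroup.mk g : Γ ⧸ K) ∈ (fun z : Γ ⧸ K => (QuotientGroup.mk y)⁻¹ * z * QuotientGroup.mk y) ''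
        ((QuotientGroup.mk (s := K)) '' (L : Set Γ)) := by
    intro L y g hg
    obtain ⟨h, hh, k, hk, hprod⟩ := Set.mem_mul.mp hg
    refine ⟨QuotientGroup.mk h, ⟨h, hh, rfl⟩, ?_⟩
    have hg' : g = y⁻¹ * (h * k) * y := by rw [hprod]; group
    rw [hg']
    simp only [QuotientGroup.mk_mul, QuotientGroup.mk_inv, (QuotientGroup.eq_one_iff k).mpr hk, mul_one]
  rcases x with v | ε | br
  · obtain ⟨w, y, rfl⟩ := P.vMk_surjective K v
    refine ⟨_, (hH w).image _, fun g hg => key (P.H w) y g ((P.deckAct_fixes_vMk_iff K g w y).mp ?_)⟩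
    exact Sum.inl_injective hg
  · obtain ⟨e, y, rfl⟩ := P.eMk_surjective K ε
    refine ⟨_, (hM e).image _, fun g hg => key (P.M e) y g ((P.deckAct_fixes_eMk_iff K g e y).mp ?_)⟩
    exact Sum.inl_injective (Sum.inr_injective hg)
  · obtain ⟨b, y, rfl⟩ := P.bMk_surjective K br
    refine ⟨_, (hM (𝔾.edgeOf b)).image _, fun g hg =>
      key (P.M (𝔾.edgeOf b)) y g ((P.deckAct_fixes_eMk_iff K g (𝔾.edgeOf b) y).mp ?_)⟩
    -- a fixed branch has a fixed edge
    have hbr : (P.deckAct K g).hom.branchMap (P.bMk K b y) = P.bMk K b y := Sum.inr_injective (Sum.inr_injective hg)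
    have := congrArg (P.cosetGraph K).edgeOf hbr
    rwa [(P.deckAct K g).hom.edgeOf_branchMap] at this

/-! ### Rigidity of close deck-equivariant endomorphisms of a coset level -/

/-- **Rigidity at a coset level** ([SemiAnbd] Prop 5.2 (i) proof made explicit, piece (P2a)).  Let `P` present a
FINITE semi-graph `𝔾` in `Γ`, `K ⊴ Γ` a normal level with FINITE images of all `H_w`, `M_ε` in `Γ ⧸ K` and CONNECTED
coset semi-graph `P.cosetGraph K`.  Then there is a FINITE `E ⊆ Γ` avoiding `K` such that for every NORMAL `L ⊇ K`
avoiding `E`, every automorphism `Ψ` of `Γ` preserving `K` and every endomorphism `t` of `P.cosetGraph K` with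
`deck(g) ≫ t = t ≫ deck(Ψ g)` which are `L`-CLOSE to the identity (`t x = deck(l_x) x` with `l_x ∈ L` on every node,
`Ψ g · g⁻¹ ∈ L`) satisfy: `Ψ g = l₀ g l₀⁻¹ k_g` with `k_g ∈ K` for ONE `l₀ ∈ L`, and `t = deck(l₀)` on nodes.
[cite: MochizukiSemiAnbd2006, Prop 5.2 (i), p. 63] -/
theorem exists_finite_forall_close_deckEquivariant_congr [K.Normal]
    [Finite 𝔾.Vertex] [Finite 𝔾.Edge] [Finite 𝔾.Branch]
    (hH : ∀ w : 𝔾.Vertex, ((QuotientGroup.mk (s := K)) '' (P.H w : Set Γ)).Finite)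
    (hM : ∀ ε : 𝔾.Edge, ((QuotientGroup.mk (s := K)) '' (P.M ε : Set Γ)).Finite)
    (hconn : (P.cosetGraph K).IsConnected) :
    ∃ E : Set Γ, E.Finite ∧ (∀ g ∈ E, g ∉ K) ∧
      ∀ (L : Subgroup Γ), L.Normal → K ≤ L → (∀ g ∈ E, g ∉ L) →
        ∀ (Ψ : Γ ≃* Γ) (t : P.cosetGraph K ⟶ P.cosetGraph K),
          (∀ k ∈ K, Ψ k ∈ K) →
          (∀ g : Γ, (P.deckAct K g).hom ≫ t = t ≫ (P.deckAct K (Ψ g)).hom) →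
          (∀ x : (P.cosetGraph K).Node, ∃ l ∈ L, Hom.nodeMap t x = Hom.nodeMap (P.deckAct K l).hom x) →
          (∀ g : Γ, Ψ g * g⁻¹ ∈ L) →
            ∃ l₀ ∈ L, (∀ g : Γ, ∃ k ∈ K, Ψ g = l₀ * g * l₀⁻¹ * k) ∧
              ∀ x : (P.cosetGraph K).Node, Hom.nodeMap t x = Hom.nodeMap (P.deckAct K l₀).hom x := by
  classical
  -- the quotient `Γ ⧸ K` acts on the nodes of the subdivision through the deck action
  let ν : Aut (P.cosetGraph K) →* Equiv.Perm (P.cosetGraph K).Node :=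
    { toFun := fun α => (subdivisionIso α).toEquiv
      map_one' := by ext x; exact Hom.nodeMap_id x
      map_mul' := fun α β => by ext x; exact Hom.nodeMap_comp β.hom α.hom x }
  let δ : Γ ⧸ K →* Equiv.Perm (P.cosetGraph K).Node := QuotientGroup.lift K (ν.comp (P.deckAct K)) (by
    intro g hg
    rw [MonoidHom.mem_ker, MonoidHom.comp_apply, P.deckAct_eq_one_of_mem K hg, map_one])
  letI : MulAction (Γ ⧸ K) (P.cosetGraph K).Node := MulAction.compHom _ δ
  have hsmul : ∀ (g : Γ) (x : (P.cosetGraph K).Node),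
      (QuotientGroup.mk g : Γ ⧸ K) • x = Hom.nodeMap (P.deckAct K g).hom x := fun _ _ => rfl
  -- the hypotheses of the generic rigidity theorem
  have hR : ∀ (q : Γ ⧸ K) (x y : (P.cosetGraph K).Node), (P.cosetGraph K).subdivision.Adj x y →
      (P.cosetGraph K).subdivision.Adj (q • x) (q • y) := by
    intro q x y h
    obtain ⟨g, rfl⟩ := QuotientGroup.mk_surjective q
    rw [hsmul, hsmul]
    exact subdivision_adj_map _ h
  have hconn' : ∀ x y : (P.cosetGraph K).Node, Relation.ReflTransGen (P.cosetGraph K).subdivision.Adj x y :=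
    fun x y => (SimpleGraph.reachable_iff_reflTransGen _ _).mp (hconn.connected x y)
  have hstab : ∀ x : (P.cosetGraph K).Node, (MulAction.stabilizer (Γ ⧸ K) x : Set (Γ ⧸ K)).Finite := by
    intro x
    obtain ⟨F, hF, hFx⟩ := P.exists_finite_forall_deckAct_nodeMap_eq K hH hM x
    refine hF.subset fun q hq => ?_
    obtain ⟨g, rfl⟩ := QuotientGroup.mk_surjective q
    exact hFx g (by rw [← hsmul]; exact hq)
  -- the nodes with representative `1` meet every orbit
  let f₀ : 𝔾.Node → (P.cosetGraph K).Node :=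
    Sum.elim (fun w => Sum.inl (P.vMk K w 1))
      (Sum.elim (fun e => Sum.inr (Sum.inl (P.eMk K e 1))) (fun b => Sum.inr (Sum.inr (P.bMk K b 1))))
  have horb : ∀ x : (P.cosetGraph K).Node, ∃ d ∈ Set.range f₀, ∃ q : Γ ⧸ K, q • d = x := by
    rintro (v | ε | br)
    · obtain ⟨w, y, rfl⟩ := P.vMk_surjective K v
      refine ⟨f₀ (Sum.inl w), ⟨_, rfl⟩, QuotientGroup.mk y⁻¹, ?_⟩
      rw [hsmul]
      change Sum.inl ((P.deckAct K y⁻¹).hom.vertexMap (P.vMk K w 1)) = Sum.inl (P.vMk K w y)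
      rw [P.deckAct_vertexMap_vMk, inv_inv, one_mul]
    · obtain ⟨e, y, rfl⟩ := P.eMk_surjective K ε
      refine ⟨f₀ (Sum.inr (Sum.inl e)), ⟨_, rfl⟩, QuotientGroup.mk y⁻¹, ?_⟩
      rw [hsmul]
      change Sum.inr (Sum.inl ((P.deckAct K y⁻¹).hom.edgeMap (P.eMk K e 1))) = Sum.inr (Sum.inl (P.eMk K e y))
      rw [P.deckAct_edgeMap_eMk, inv_inv, one_mul]
    · obtain ⟨b, y, rfl⟩ := P.bMk_surjective K br
      refine ⟨f₀ (Sum.inr (Sum.inr b)), ⟨_, rfl⟩, QuotientGroup.mk y⁻¹, ?_⟩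
      rw [hsmul]
      change Sum.inr (Sum.inr ((P.deckAct K y⁻¹).hom.branchMap (P.bMk K b 1))) = Sum.inr (Sum.inr (P.bMk K b y))
      rw [P.deckAct_branchMap_bMk, inv_inv, one_mul]
  obtain ⟨x₀⟩ := hconn.connected.nonempty
  have hDne : (Set.range f₀).Nonempty := by
    obtain ⟨d, hd, -⟩ := horb x₀
    exact ⟨d, hd⟩
  -- the generic rigidity theorem in `Γ ⧸ K`
  haveI : Finite 𝔾.Node := inferInstanceAs (Finite (𝔾.Vertex ⊕ (𝔾.Edge ⊕ 𝔾.Branch)))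
  obtain ⟨E₀, hE₀, h1, hmain⟩ := exists_finite_forall_closeEquivariant_conj (Γ := Γ ⧸ K)
    (P.cosetGraph K).subdivision.Adj hR hconn' (P.exists_finite_setOf_subdivision_adj_cosetGraph K hH) hstab
    (Set.range f₀) (Set.finite_range f₀) hDne horb
  refine ⟨Quotient.out '' E₀, hE₀.image _, ?_, ?_⟩
  · rintro _ ⟨q, hq, rfl⟩ hK
    apply h1
    rwa [← QuotientGroup.out_eq' q, (QuotientGroup.eq_one_iff _).mpr hK] at hq
  intro L hL hKL hLE Ψ t hΨK hequiv hclose hΨ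
  -- the image `Λ` of `L` in `Γ ⧸ K`: normal and disjoint from `E₀`
  let Λ : Subgroup (Γ ⧸ K) := L.map (QuotientGroup.mk' K)
  have hΛ : Λ.Normal := hL.map _ (QuotientGroup.mk'_surjective K)
  have hdisj : Disjoint (Λ : Set (Γ ⧸ K)) E₀ := by
    refine Set.disjoint_left.mpr fun q hq hqE => ?_
    obtain ⟨l, hl, hlq⟩ := Subgroup.mem_map.mp hq
    refine hLE q.out ⟨q, hqE, rfl⟩ ?_
    have hk : l⁻¹ * q.out ∈ K := by
      rw [← QuotientGroup.eq, QuotientGroup.out_eq']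
      exact hlq
    have : q.out = l * (l⁻¹ * q.out) := by group
    rw [this]
    exact L.mul_mem hl (hKL hk)
  -- the induced map on `Γ ⧸ K` and the node map of `t`
  have hKK : K ≤ K.comap Ψ.toMonoidHom := fun k hk => hΨK k hk
  let ψ : Γ ⧸ K → Γ ⧸ K := QuotientGroup.map K K Ψ.toMonoidHom hKK
  have hψmk : ∀ g : Γ, ψ (QuotientGroup.mk g) = QuotientGroup.mk (Ψ g) := fun g => rfl
  have hequiv' : ∀ (q : Γ ⧸ K) (x : (P.cosetGraph K).Node),
      Hom.nodeMap t (q • x) = ψ q • Hom.nodeMap t x := by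
    intro q x
    obtain ⟨g, rfl⟩ := QuotientGroup.mk_surjective q
    rw [hψmk, hsmul, hsmul, ← Hom.nodeMap_comp, ← Hom.nodeMap_comp, hequiv g]
  have hRt : ∀ x y : (P.cosetGraph K).Node, (P.cosetGraph K).subdivision.Adj x y →
      (P.cosetGraph K).subdivision.Adj (Hom.nodeMap t x) (Hom.nodeMap t y) :=
    fun _ _ h => subdivision_adj_map t h
  have hclose' : ∀ x : (P.cosetGraph K).Node, ∃ l ∈ Λ, Hom.nodeMap t x = l • x := by
    intro x
    obtain ⟨l, hl, hx⟩ := hclose x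
    exact ⟨QuotientGroup.mk l, Subgroup.mem_map.mpr ⟨l, hl, rfl⟩, by rw [hsmul]; exact hx⟩
  have hψ' : ∀ q : Γ ⧸ K, ψ q * q⁻¹ ∈ Λ := by
    intro q
    obtain ⟨g, rfl⟩ := QuotientGroup.mk_surjective q
    rw [hψmk]
    exact Subgroup.mem_map.mpr ⟨Ψ g * g⁻¹, hΨ g, by simp⟩
  obtain ⟨l₀', hl₀', htX, hψX⟩ := hmain Λ hΛ hdisj ψ (Hom.nodeMap t) hequiv' hRt hclose' hψ'
  obtain ⟨l₀, hl₀, rfl⟩ := Subgroup.mem_map.mp hl₀'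
  refine ⟨l₀, hl₀, fun g => ?_, fun x => by rw [htX x]; exact hsmul l₀ x⟩
  -- `Ψ g ≡ l₀ g l₀⁻¹ (mod K)`
  have h := hψX (QuotientGroup.mk g)
  rw [hψmk] at h
  change (QuotientGroup.mk (Ψ g) : Γ ⧸ K) = QuotientGroup.mk l₀ * QuotientGroup.mk g * (QuotientGroup.mk l₀)⁻¹ at h
  rw [← QuotientGroup.mk_mul, ← QuotientGroup.mk_inv, ← QuotientGroup.mk_mul, eq_comm, QuotientGroup.eq] at h
  exact ⟨(l₀ * g * l₀⁻¹)⁻¹ * Ψ g, h, by group⟩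

end SubgroupPresentation

end SemiGraph

end Literature.AnabelianGeometry.SemiGraphs
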